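import Literature.NumberTheory.EllipticCurves.AnticyclotomicInertiaAboveP
import Literature.NumberTheory.EllipticCurves.SubgroupSelmer
import Literature.NumberTheory.EllipticCurves.KodairaNeronUnramifiedInertiaProofs
import Literature.NumberTheory.GaloisRepresentations.UnramifiedQuotientTraceProofs
import Literature.NumberTheory.Automorphic.AdicCompletionLocalField
import HarnessLib

/-!
# Local form of «`K̃_∞/K_∞⁻` is unramified above a split prime»: the local inertia of the
# anticyclotomic line dies in every `ℤ_p`-tower, and the relative trace form it feeds

Topic `NumberTheory/EllipticCurves` (Iwasawa theory of `ℤ_p`-extensions).  THEOREMS ONLY (no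
definition, no named fact, no instance).

Let `K` be an imaginary quadratic field, `p` odd and SPLIT in `K` (`v ≠ v̄` above `p`), `κ₁` an
anticyclotomic `ℤ_p`-extension and `κ₂` ANY `ℤ_p`-extension of `K` (e.g. the cyclotomic one).
The tree's GLOBAL theorem `ZpExtension.inertia_inf_kerSubgroup_le_kerSubgroup_of_isAnticyclotomic`
(file `AnticyclotomicInertiaAboveP`; Greenberg LNM 1716 §1 p. 53, Greenberg 1978 §4 p. 94, Brink
2007 Cor. 1) says `I_𝔓 ⊓ ker κ₁ ≤ ker κ₂` for every prime `𝔓` of `\bar ℤ_K` above `p`.  Read at the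
prime `𝔓₀ = adicCompletionPrime K v` cut out by the chosen embedding `K̄ → K̄_v`, whose inertia
group is `res (I_{K_v})` (`inertia_adicCompletionPrime_eq_map_absInertia`, Neukirch II (9.6)), this
is the LOCAL statement

* §1 `localSubgroup_kerSubgroup_inf_absInertia_le_of_isAnticyclotomic`:
  `(ker κ₁)_v ⊓ I_{K_v} ≤ (ker κ₂)_v` in `Γ_{K_v}` (`(ker κ)_v = localSubgroup κ.kerSubgroup K_v`,
  `I_{K_v} = absInertia K_v`): the inertia subgroup of `Gal(K̄_v/K⁻_{∞,w})` acts trivially on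
  `K_{∞,w}^{κ₂}`, i.e. `K⁻_{∞,w} K^{κ₂}_{∞,w} / K⁻_{∞,w}` is an UNRAMIFIED `ℤ_p`-extension of the
  (non-complete) field `K⁻_{∞,w}`;

together with the bookkeeping its consumer needs (§1: `(ker κ)_v` is normal and closed in
`Γ_{K_v}`), and

* §2 `exists_trace_gt_of_inf_absInertia_le` (generic, no `ℤ_p`-extension): for a closed
  `G ≤ Γ_{K_v}` and `N` with `G ⊓ I_{K_v} ≤ N`, the RELATIVE TRACE FORM above `N` — for every open
  `O ⊇ N` and `ρ < 1` an integral `x ∈ K̄_v` fixed by `O ⊓ G` with `ρ < |Σ_{q ∈ G/(G ∩ O)} q • x|_v`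
  (`|·|_v` the spectral valuation `w`, as in `CoatesGreenberg1996.deeplyRamified_cyclotomic_trace`)
  — from the unit-trace element of an unramified finite quotient
  (`exists_smul_eq_of_algNorm_le_one_of_sum_smul_eq_one`, whose orbit sum is exactly `1`);
  §2 `exists_trace_gt_localSubgroup_of_isAnticyclotomic`: the instance `G = (ker κ₁)_v`,
  `N = (ker κ₁)_v ⊓ (ker κ₂)_v` on the anticyclotomic frames.

Consumer: the frame-restricted discharge of Greenberg's Prop. 2.4 (LNM 1716) / Coates–Greenberg
Prop. 4.3 for the anticyclotomic tower at a split prime (cell `pub/bsd-print-x9`, item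
stmt-BirchSwinnertonDyer-23237, road CG-FRAME, brick (C)): `H¹((ker κ⁻)_v, E₁(K̄_v)) = 0` by
restriction to `N = (ker κ⁻)_v ⊓ (ker κ^{cyc})_v` (Coates–Greenberg Cor. 3.2, tree theorem
`H1_goodModelKernel_trivial_holds`) and the relative trace form above `N` (this file).  Nothing here
concerns an elliptic curve; BSD is not advanced by this file beyond supplying a class-field-theoretic
input by a kernel theorem.

References: R. Greenberg, LNM 1716 (1999) §1 p. 53, §2 pp. 83–84 [GreenbergLNM1716]; R. Greenberg,
Invent. Math. 47 (1978) §4 p. 94 [Greenberg1978]; J. Neukirch, *Algebraic Number Theory* (1999)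
Ch. II §9 Prop. (9.6) [NeukirchANT1999]; J.-P. Serre, *Local Fields* (1979) Ch. V §1
[SerreLocalFields1979]; J. Coates, R. Greenberg, Invent. Math. 124 (1996) §2–§3 [CoatesGreenberg1996].
-/

noncomputable section

open scoped NumberField NNReal
open Field NumberField IsDedekindDomain IsDedekindDomain.HeightOneSpectrum

namespace Literature.NumberTheory.EllipticCurves.ZpExtension

open Literature.NumberTheory.GaloisRepresentations

variable {K : Type} [Field K] [NumberField K] {p : ℕ} [Fact p.Prime]

/-! ## §1 The local inertia of the anticyclotomic line dies in every `ℤ_p`-tower -/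

/-- The local subgroup `H_v = res⁻¹(H) ≤ Γ_{K_v}` of a NORMAL subgroup `H ⊴ Γ_K` is normal (preimage
of a normal subgroup).  Serre, *Galois Cohomology*, II.§1.1; Neukirch, *ANT* II §9 (the
decomposition group `G_w ≅ G(L_w|K_v)`). [cite: NeukirchANT1999, Ch. II §9 Prop. (9.6)] -/
theorem localSubgroup_normal (H : Subgroup (absoluteGaloisGroup K)) [hH : H.Normal]
    (v : HeightOneSpectrum (𝓞 K)) : (localSubgroup H (v.adicCompletion K)).Normal := by
  rw [localSubgroup_eq_comap]
  exact hH.comap _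

/-- `(ker κ)_v` is a normal subgroup of `Γ_{K_v}` (`ker κ` is normal in `Γ_K`, `Γ_K/ker κ ≅ ℤ_p`
being abelian). [cite: GreenbergLNM1716, §2 pp. 83–84 (the local groups of a ℤ_p-extension)]
[cite: NeukirchANT1999, Ch. II §9 Prop. (9.6)] -/
theorem localSubgroup_kerSubgroup_normal (κ : ZpExtension K p) (v : HeightOneSpectrum (𝓞 K)) :
    (localSubgroup κ.kerSubgroup (v.adicCompletion K)).Normal := by
  haveI : κ.kerSubgroup.Normal := by
    rw [kerSubgroup]
    exact MonoidHom.normal_ker _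
  exact localSubgroup_normal κ.kerSubgroup v

/-- `(ker κ)_v` is closed in `Γ_{K_v}` (preimage of the closed `ker κ` under the continuous
restriction). [cite: GreenbergLNM1716, §2 pp. 83–84] [cite: NeukirchANT1999, Ch. II §9 Prop. (9.6)] -/
theorem isClosed_localSubgroup_kerSubgroup (κ : ZpExtension K p) (v : HeightOneSpectrum (𝓞 K)) :
    IsClosed ((localSubgroup κ.kerSubgroup (v.adicCompletion K) :
      Subgroup (absoluteGaloisGroup (v.adicCompletion K))) : Set (absoluteGaloisGroup (v.adicCompletion K))) :=
  κ.isClosed_kerSubgroup.preimage (map_continuous (resGal (K := K) (v.adicCompletion K)))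

/-- **`(ker κ₁)_v ⊓ I_{K_v} ≤ (ker κ₂)_v` — the local inertia of the anticyclotomic line dies in
every `ℤ_p`-tower.**  For `K` imaginary quadratic, `p` odd and split in `K` (`v ≠ v̄` above `p`),
`κ₁` anticyclotomic and `κ₂` any `ℤ_p`-extension of `K`: an element of the local inertia group
`I_{K_v} = absInertia K_v` whose restriction to `K̄` fixes `K_∞^{κ₁}` fixes `K_∞^{κ₂}`.  This is the
tree's global `inertia_inf_kerSubgroup_le_kerSubgroup_of_isAnticyclotomic` (`I_𝔓 ⊓ ker κ₁ ≤ ker κ₂`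
for every `𝔓 ∣ p`) at the prime `𝔓₀ = adicCompletionPrime K v` of the chosen embedding, whose
inertia group is `res (I_{K_v})` (`inertia_adicCompletionPrime_eq_map_absInertia`).  In field
language: `K_{∞,w}^{κ₁} K_{∞,w}^{κ₂} / K_{∞,w}^{κ₁}` is unramified (Greenberg LNM 1716 §1 p. 53:
"`F̃/F_∞` is unramified if `p` … splits completely").
[cite: GreenbergLNM1716, §1 p. 53] [cite: Greenberg1978, §4 p. 94]
[cite: NeukirchANT1999, Ch. II §9 Prop. (9.6)] -/
theorem localSubgroup_kerSubgroup_inf_absInertia_le_of_isAnticyclotomic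
    (hK : IsImaginaryQuadratic K) (hp2 : p ≠ 2) {κ₁ : ZpExtension K p} (hκ₁ : κ₁.IsAnticyclotomic)
    (κ₂ : ZpExtension K p) {v vbar : HeightOneSpectrum (𝓞 K)} (hpv : ((p : ℕ) : 𝓞 K) ∈ v.asIdeal)
    (hpvbar : ((p : ℕ) : 𝓞 K) ∈ vbar.asIdeal) (hne : vbar ≠ v) :
    localSubgroup κ₁.kerSubgroup (v.adicCompletion K) ⊓ absInertia (v.adicCompletion K) ≤
      localSubgroup κ₂.kerSubgroup (v.adicCompletion K) := by
  intro σ hσ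
  obtain ⟨hσ₁, hσI⟩ := Subgroup.mem_inf.mp hσ
  rw [mem_localSubgroup_iff] at hσ₁ ⊢
  -- `res σ` lies in the inertia group of `𝔓₀ = adicCompletionPrime K v`
  have hres : resGal (K := K) (v.adicCompletion K) σ ∈
      (adicCompletionPrime K v).inertia (absoluteGaloisGroup K) := by
    rw [inertia_adicCompletionPrime_eq_map_absInertia]
    exact Subgroup.mem_map_of_mem _ hσI
  exact inertia_inf_kerSubgroup_le_kerSubgroup_of_isAnticyclotomic hK hp2 hκ₁ κ₂ hpv hpvbar hne
    hpv (adicCompletionPrime_mem_primesAbove K v) (Subgroup.mem_inf.mpr ⟨hres, hσ₁⟩)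

/-- Corollary: with `N := (ker κ₁)_v ⊓ (ker κ₂)_v`, **`(ker κ₁)_v ⊓ I_{K_v} ≤ N`** — the shape in
which the relative trace form (§2) and the restriction step of Coates–Greenberg Cor. 3.2 consume
§1. [cite: GreenbergLNM1716, §1 p. 53] -/
theorem localSubgroup_kerSubgroup_inf_absInertia_le_inf_of_isAnticyclotomic
    (hK : IsImaginaryQuadratic K) (hp2 : p ≠ 2) {κ₁ : ZpExtension K p} (hκ₁ : κ₁.IsAnticyclotomic)
    (κ₂ : ZpExtension K p) {v vbar : HeightOneSpectrum (𝓞 K)} (hpv : ((p : ℕ) : 𝓞 K) ∈ v.asIdeal)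
    (hpvbar : ((p : ℕ) : 𝓞 K) ∈ vbar.asIdeal) (hne : vbar ≠ v) :
    localSubgroup κ₁.kerSubgroup (v.adicCompletion K) ⊓ absInertia (v.adicCompletion K) ≤
      localSubgroup κ₁.kerSubgroup (v.adicCompletion K) ⊓
        localSubgroup κ₂.kerSubgroup (v.adicCompletion K) :=
  le_inf inf_le_left
    (localSubgroup_kerSubgroup_inf_absInertia_le_of_isAnticyclotomic hK hp2 hκ₁ κ₂ hpv hpvbar hne)

end Literature.NumberTheory.EllipticCurves.ZpExtension

/-! ## §2 The relative trace form above an «unramified» closed subgroup -/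

namespace Literature.NumberTheory.GaloisRepresentations

open Literature.NumberTheory.EllipticCurves IsNonarchimedeanLocalField

variable {K : Type} [Field K] [NumberField K]

/-- **Relative trace form above `N` for an «unramified» quotient** (generic).  Let `G ≤ Γ_{K_v}` be
closed (fixed field `L`), `N` a subgroup with `G ⊓ I_{K_v} ≤ N` (the inertia of `L` lies in `N`),
`w` the spectral valuation of `K̄_v` (`hw`).  Then for every OPEN `O ⊇ N` with `[G : G ∩ O] < ∞`
and every `ρ < 1` there is `x ∈ K̄_v` with `w x ≤ 1`, fixed by `O ⊓ G`, and
`ρ < w (Σ_{q ∈ G/(G ∩ O)} q • x)` — indeed the unit-trace element of the unramified finite quotient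
`G/(G ∩ O)` (`exists_smul_eq_of_algNorm_le_one_of_sum_smul_eq_one`: orbit sum EXACTLY `1`) serves
every `ρ`.  This is the inner block of `CoatesGreenberg1996.deeplyRamified_cyclotomic_trace`
(binders verbatim) RELATIVE to `N`, the hypothesis shape of the subquotient form of Coates–Greenberg
Cor. 3.2.  Serre, *Local Fields* V §1 (the trace of an unramified extension is surjective on
integers). [cite: SerreLocalFields1979, Ch. V §1] [cite: CoatesGreenberg1996, §2 p. 143 (iii), §3] -/
theorem exists_trace_gt_of_inf_absInertia_le (v : HeightOneSpectrum (𝓞 K))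
    (w : Valuation (AlgebraicClosure (v.adicCompletion K)) ℝ≥0)
    (hw : ∀ x, (w x : ℝ) =
      spectralNorm (v.adicCompletion K) (AlgebraicClosure (v.adicCompletion K)) x)
    (G : Subgroup (absoluteGaloisGroup (v.adicCompletion K)))
    (hGc : IsClosed (G : Set (absoluteGaloisGroup (v.adicCompletion K))))
    (N : Subgroup (absoluteGaloisGroup (v.adicCompletion K)))
    (hI : G ⊓ absInertia (v.adicCompletion K) ≤ N)
    (O : Subgroup (absoluteGaloisGroup (v.adicCompletion K)))
    (hO : IsOpen (O : Set (absoluteGaloisGroup (v.adicCompletion K)))) (hNO : N ≤ O)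
    [Fintype (G ⧸ O.subgroupOf G)] (ρ : ℝ≥0) (hρ : ρ < 1) :
    ∃ x : AlgebraicClosure (v.adicCompletion K), w x ≤ 1 ∧ (∀ u ∈ O ⊓ G, u • x = x) ∧
      ρ < w (∑ q : G ⧸ O.subgroupOf G, ((q.out : G) : absoluteGaloisGroup (v.adicCompletion K)) • x) := by
  haveI : CharZero (v.adicCompletion K) :=
    charZero_of_injective_algebraMap (algebraMap K (v.adicCompletion K)).injective
  obtain ⟨x, hx1, hxO, hsum⟩ := exists_smul_eq_of_algNorm_le_one_of_sum_smul_eq_one G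
    hGc.isCompact O hO (hI.trans hNO)
  refine ⟨x, (spectralValuation_le_one_iff_algNorm_le_one hw x).mpr hx1, hxO, ?_⟩
  rw [hsum, map_one]
  exact hρ

/-- **Relative trace form above `N = (ker κ₁)_v ⊓ (ker κ₂)_v` on the anticyclotomic frames.**  For
`K` imaginary quadratic, `p` odd and split (`v ≠ v̄` above `p`), `κ₁` anticyclotomic, `κ₂` any
`ℤ_p`-extension (e.g. the cyclotomic one), `G = (ker κ₁)_v`, `N = G ⊓ (ker κ₂)_v`: for every open
`O ⊇ N` with `[G : G ∩ O] < ∞` and `ρ < 1` there is an integral `x ∈ K̄_v` fixed by `O ⊓ G` with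
`ρ < w (Σ_{q ∈ G/(G ∩ O)} q • x)` (§1 + `exists_trace_gt_of_inf_absInertia_le`).  The hypothesis
(h₂) of the subquotient form of Coates–Greenberg Cor. 3.2 on the frames of road CG-FRAME.
[cite: GreenbergLNM1716, §1 p. 53, §2 pp. 83–84] [cite: SerreLocalFields1979, Ch. V §1]
[cite: CoatesGreenberg1996, §2 p. 143 (iii), §3] -/
theorem exists_trace_gt_localSubgroup_of_isAnticyclotomic {p : ℕ} [Fact p.Prime]
    (hK : IsImaginaryQuadratic K) (hp2 : p ≠ 2) {κ₁ : ZpExtension K p} (hκ₁ : κ₁.IsAnticyclotomic)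
    (κ₂ : ZpExtension K p) {v vbar : HeightOneSpectrum (𝓞 K)} (hpv : ((p : ℕ) : 𝓞 K) ∈ v.asIdeal)
    (hpvbar : ((p : ℕ) : 𝓞 K) ∈ vbar.asIdeal) (hne : vbar ≠ v)
    (w : Valuation (AlgebraicClosure (v.adicCompletion K)) ℝ≥0)
    (hw : ∀ x, (w x : ℝ) =
      spectralNorm (v.adicCompletion K) (AlgebraicClosure (v.adicCompletion K)) x)
    (O : Subgroup (absoluteGaloisGroup (v.adicCompletion K)))
    (hO : IsOpen (O : Set (absoluteGaloisGroup (v.adicCompletion K))))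
    (hNO : localSubgroup κ₁.kerSubgroup (v.adicCompletion K) ⊓
      localSubgroup κ₂.kerSubgroup (v.adicCompletion K) ≤ O)
    [Fintype (localSubgroup κ₁.kerSubgroup (v.adicCompletion K) ⧸
      O.subgroupOf (localSubgroup κ₁.kerSubgroup (v.adicCompletion K)))]
    (ρ : ℝ≥0) (hρ : ρ < 1) :
    ∃ x : AlgebraicClosure (v.adicCompletion K), w x ≤ 1 ∧
      (∀ u ∈ O ⊓ localSubgroup κ₁.kerSubgroup (v.adicCompletion K), u • x = x) ∧
      ρ < w (∑ q : localSubgroup κ₁.kerSubgroup (v.adicCompletion K) ⧸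
          O.subgroupOf (localSubgroup κ₁.kerSubgroup (v.adicCompletion K)),
        ((q.out : localSubgroup κ₁.kerSubgroup (v.adicCompletion K)) :
          absoluteGaloisGroup (v.adicCompletion K)) • x) :=
  exists_trace_gt_of_inf_absInertia_le v w hw _ (ZpExtension.isClosed_localSubgroup_kerSubgroup κ₁ v)
    _ (ZpExtension.localSubgroup_kerSubgroup_inf_absInertia_le_inf_of_isAnticyclotomic hK hp2 hκ₁ κ₂
      hpv hpvbar hne) O hO hNO ρ hρ

end Literature.NumberTheory.GaloisRepresentations

end
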